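import Summits.QuantumFields.YangMills.Theorems.UnitScaleTiltHistoryTailLaneTailV4Chi
import Summits.QuantumFields.YangMills.Theses.UnitScaleTilt
import HarnessLib

/-!
# BC3 birth skeleton v5p10 — LEAD PEN ym-ust-19936-w1 g3 under ★★OWNER ym3-torus-plan g26 RULING g26-№14 (b) (2026-08-28T07:54:59Z): v5p9's THIN RE-CUT moved to the
# VERSION-4 χ-record (R-ii: the (67) large-field row in the RECORDING∕symmetric currency, consumed as (71) per recorded plaquette — `RunAlphaV4*AC := v3 with hLF67 ↦ h71`,
# ★alpha-2 g7 ✓p615034 `…v4Lane` + ✓p615341 `…v4Chi`) — crux `HistoryTailL` (route `UnitScaleTilt`, item stmt-QuantumFields-19936); ns `…Cruxes.HistoryTailL.BirthV5p10`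

WHY v5p10 (located defect of v5p9, evidence #60 on the item + RULING g26-№13 (ii)∕№14): v5p9's single stub `stub_laneRecordsV3Chi` unfolds to a package whose field `hLF67` asks
(67)-largeness of the composite minimiser's COMB `j`-fold average at the recording threshold `eps1Of` with margin 0 — NOT suppliable by print's (42)-minimiser at the frozen-field
selection (the history masses record largeness of the SYMMETRIC `blockAvg ℰp` variable; comb and symmetric averages differ at second order; ★w6-19936 g2 memo
`LOCATE-alpha-seam-w6-g2.md` 44fcc0efa923e0a2).  The v4 record replaces that row by its only use, the (71) small factor per recorded plaquette (currency-free; print p.273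
L11–22), additively (v3 ⇒ v4 is a theorem: ✓`alphaInputsT3ACv4RecChi_of_v3`).  v5p9 stays in the tree, BANKED.

v5p10 (this file): ONE stub — {2′χ-v4 `stub_laneRecordsV4Chi`} = NODE O d = 3's χ-record in the v4 text (THE content: [Balaban1985UV3] Sect. B–C expansion data for a nested-regular
constrained selection, B1 display ✓`AlphaInputsT3AC.NestedRegularSelT3` ⇒ ✓`InClassSelT3Xs` ⇒ ✓`laneRecordsV4Chi_of_thm1In8_nestedDataRows`; the (71) seam row supplied floor-free by
✓`SmallFactor71Sym.h71_of_large69` + (69)_sym ✓`…SymAvgSixtyNineOfExpansion` + engine ✓`EMLIterUniform.norm_iter_sub_one_sub_iterLin_le_uniform_dL`) — byte-identical with 20520 v5kD's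
stub (2) (ONE shared item) — and the one-line composition `HistoryTailL_of` through the LANDED v4 door ✓`HistoryTailLaneTailV4Chi.historyTailL_of_laneRecordsV4Chi` (★w3-19936 g5, ✓p620914 (P18 ✓p620593); the v4 twin of
the v3 closer ✓`HistoryTailLaneTailChi.historyTailL_of_laneRecordsChi` over ★alpha-2 g7's v4 package, trunk∕branches ★w3 g5∕★w6 g2∕★w4 g4∕★w7 g3).
[cite: Balaban1985UV3, (5) p.256, (41) p.266, (47) p.267, (71) p.273 and Thm 2 p.272; Balaban1985Variational, Thm 1 (8) p.279]
-/

set_option autoImplicit false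

namespace Summit.QuantumFields.YangMills.Cruxes.HistoryTailL.BirthV5p10

/-! ## §1 The registered stub (the ONLY sorry) -/

/-- STUB 2′χ-v4 (XXL, lane-owned = the END theorem of pub-balaban3d's χ-lineage modulo NODE O d = 3, VERSION 4: print's lower row (47) «χ·χ_k», the core (α) rows at the (40)
windows with the large-field input read as (71) PER RECORDED PLAQUETTE (`RunAlphaV4ChiAC.h71`), minimiser rows r1–r3, terminal rows; text = `AlphaInputsT3ACv3RecChi`'s with
`OfV3ChiAt ↦ OfV4ChiAt`) — BAŁABAN'S (α) INPUT ROWS, v4, HOLD FOR THE PINNED CARRIER AT EVERY SUFFICIENTLY LARGE PROFILE: ★alpha-2 g7's Prop `Theorems.AlphaInputsT3ACv4RecChi L`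
BY NAME (implied by the v3 text: ✓`alphaInputsT3ACv4RecChi_of_v3`). [cite: Balaban1985UV3, Thm 1 p.257, (7) p.257, (47) p.267, (55) p.269, (71) p.273 and Thm 2 p.272] -/
theorem stub_laneRecordsV4Chi : ∀ L : ℕ, Odd L → 1 < L → Summit.QuantumFields.YangMills.Theorems.AlphaInputsT3ACv4RecChi L := by
  sorry

/-! ## §2 The crux BY NAME — no sorry below this line -/

/-- **`HistoryTailL ⇐ stub_laneRecordsV4Chi` THROUGH THE LANDED v4 DOOR** (✓`HistoryTailLaneTailV4Chi.historyTailL_of_laneRecordsV4Chi`) — the load-bearing item stmt-QuantumFields-19936 BY NAME. [cite: Balaban1985UV3, (5) p.256 and (71) p.273; King1986, (3.12) p.657] -/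
theorem HistoryTailL_of : Summit.QuantumFields.YangMills.Theses.UnitScaleTilt.HistoryTailL :=
  Summit.QuantumFields.YangMills.Theorems.HistoryTailLaneTailV4Chi.historyTailL_of_laneRecordsV4Chi stub_laneRecordsV4Chi

end Summit.QuantumFields.YangMills.Cruxes.HistoryTailL.BirthV5p10
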